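import Summits.QuantumFields.YangMills.Theorems.IR.ShellMaxCorrKernelAvg

/-!
# Crux `IR` (item stmt-QuantumFields-19354) — line «maximal correlation at one physical thickness»:
THE ABSTRACT MAXIMAL-CORRELATION THEOREM (variance of a kernel average under Dobrushin's condition)

Helper module for item `stmt-QuantumFields-19354` (`--supports … --as helper`; it closes nothing; lead prover
ym-ir-line-mxc-p1, g2).  Input (B) of the g2 route to the registered stub `ShellMaxCorr.stub_shellRung : ShellRung`
(`Theorems/IR/ShellMaxCorrDefs.lean`), assembled with (P) = `Theorems/IR/ShellMaxCorrPoincare.lean`.  Setting: a GENERAL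
specification `γ` on `V → S` (`V` finite) with Dobrushin's condition in the total-variation form
(`DobrushinMetric.IsKRContraction γ 1 nbr C`, row sums `≤ α`), a Gibbs measure `μ`, a finite volume `W` with complement
`B = Wᶜ` («boundary / outside»), and for a bounded measurable `f` reading only `W` its kernel average
`h(η) = γ_W f(η) = ∫ f dγ_W(·|η)` (a version of `E_μ[f | 𝓕_B]`, `ShellMaxCorrKernelAvg.lean` §2).

**Theorem (`integral_sq_kernelAvg_sub_le`).**  Assume
 (H1) the one-site laws have density `≤ K` w.r.t. a reference probability measure `m` on `S`;
 (H2) changing the boundary condition at ONE site `x ∈ B` tilts the kernel by a positive factor: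
      `γ_W F(η^{x←s}) · γ_W(ρ_{x,s})(η) = γ_W(F ρ_{x,s})(η)` for `W`-local `F`, with `0 < ρlo ≤ ρ_{x,s} ≤ ρhi`;
 (H3) a Schur bound `Λ ≥ 0` on the rows of the Gram matrix of the tilting factors under every kernel `γ_W(·|η)`:
      `∑_{x' ∈ B} |Cov_{γ_W(η)}(ρ_{x,s_x}, ρ_{x',s_{x'}})| ≤ Λ` for every `η`, every selection `s` and every `x ∈ B`.
Then `(1 − α) Var_μ(γ_W f) ≤ (K Λ / ρlo²) · Var_μ(f)`.
Proof: the Poincaré inequality (`HeatBath.poincare_of_isKRContraction_one`) for `h = γ_W f` — only the sites of `B`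
contribute, the kernel being `𝓕_B`-measurable; Jensen `(h − T_x h)² ≤ ∫ (h(η) − h(η^{x←s}))² γ_x(ds|η) ≤ K ∫ … dm(s)`;
(H2) gives `h(η^{x←s}) − h(η) = Cov_{γ_W(η)}(f, ρ_{x,s}) / γ_W(ρ_{x,s})(η)`; for each SELECTION `s : V → S` the
Bessel/Schur inequality (`HeatBath.sum_sq_integral_mul_le`) gives `∑_{x∈B} Cov(f, ρ_{x,s_x})² ≤ Λ Var_{γ_W(η)}(f)`;
summing the `m`-integrals over `x` is one `m^{⊗V}`-integral of the selection sum (marginals of the product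
measure), and `∫ Var_{γ_W(η)}(f) dμ ≤ Var_μ f` finishes.

For the torus Wilson measure (H1)–(H3) are supplied by `Theorems/IR/ShellMaxCorrBoundaryTilt.lean` and its sequel with
`K = e^{O(β)}`, `ρlo = e^{−O(β)}`, `Λ = O(β²)`, `α = O(β)`: `Var_μ(E[f|𝓕_B]) ≤ O(β²) Var_μ f` uniformly in the
volume and in `W` — the radius-uniform maximal-correlation bound the rung needs.

HONEST FRAMING: abstract probability; nothing here proves `ShellRung`, the loads, or any mass gap.

Refs: L. Wu, Ann. Probab. 34 (2006) 1960 (Poincaré under Dobrushin); R. C. Bradley, Probab. Surveys 2 (2005) 107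
(ρ*-mixing coefficients).
-/

set_option autoImplicit false

noncomputable section

open MeasureTheory ProbabilityTheory Finset Function Filter
open Literature.Probability.LatticeModels Literature.Probability.LatticeModels.DobrushinMetric
open Summit.QuantumFields.YangMills.Cruxes.IR.CollarDecoupling (sq_integral_mul_le)

namespace Summit.QuantumFields.YangMills.Cruxes.IR.ShellMaxCorr.HeatBath

/-! ## §3 The variance of a kernel average: Poincaré + Bessel -/

section Transfer

variable {V S : Type*} [MeasurableSpace S] {γ : Specification V S} {nbr : V → Finset V} {C : V → V → ℝ}
  [Fintype V] [DecidableEq V] [Nonempty V] [Nonempty S] {μ : Measure (V → S)}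

omit [Fintype V] [Nonempty V] [Nonempty S] in
/-- Jensen for the one-site average: `(h η − T_x h η)² ≤ ∫ (h η − h(η^{x←s}))² γ_x(ds|η)`. -/
theorem sq_sub_siteAvg_le (hγ : IsSpecification γ) (x : V) {h : (V → S) → ℝ} (hhm : Measurable h) {M : ℝ}
    (hM : ∀ σ, |h σ| ≤ M) (η : V → S) :
    (h η - siteAvg γ x h η) ^ 2 ≤ ∫ s, (h η - h (update η x s)) ^ 2 ∂(siteLaw γ x η) := by
  haveI := isProbabilityMeasure_siteLaw hγ x η
  have hφm : Measurable fun s => h η - h (update η x s) := measurable_const.sub (hhm.comp (measurable_update η))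
  have hφb : ∀ s, |h η - h (update η x s)| ≤ M + M := fun s =>
    (abs_sub _ _).trans (add_le_add (hM _) (hM _))
  have hsub : h η - siteAvg γ x h η = ∫ s, (h η - h (update η x s)) ∂(siteLaw γ x η) := by
    have hi : Integrable (fun s => h (update η x s)) (siteLaw γ x η) :=
      integrable_of_abs_le_const _ (hhm.comp (measurable_update η)) fun s => hM _
    rw [siteAvg_eq_integral_siteLaw hγ x hhm, integral_sub (integrable_const _) hi]
    simp
  rw [hsub]
  have hcs := sq_integral_mul_le (siteLaw γ x η) hφm measurable_const hφb (fun _ => le_of_eq abs_one)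
    (v := fun _ => (1 : ℝ))
  simpa using hcs

/-- **The variance of a kernel average under Dobrushin's condition (abstract maximal-correlation theorem).**
See the module docstring for (H1)–(H3). -/
theorem integral_sq_kernelAvg_sub_le (hγ : IsSpecification γ)
    (hC : IsKRContraction γ (fun _ _ => (1 : ℝ)) nbr C) {α : ℝ} (hrow : ∀ x, ∑ y ∈ nbr x, C x y ≤ α)
    (hμ : IsGibbsMeasure γ μ) (W : Finset V)
    -- (H1) one-site laws dominated by `K · m`
    (m : Measure S) [IsProbabilityMeasure m] {K : ℝ} (hK : 0 ≤ K)
    (hH1 : ∀ (x : V) (η : V → S) (φ : S → ℝ), Measurable φ → (∀ s, 0 ≤ φ s) → (∃ B, ∀ s, φ s ≤ B) →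
      ∫ s, φ s ∂(siteLaw γ x η) ≤ K * ∫ s, φ s ∂m)
    -- (H2) one-site boundary changes tilt the kernel by a positive factor
    (ρ : V → S → (V → S) → ℝ) (hρm : ∀ x s, Measurable (ρ x s)) {ρlo ρhi : ℝ} (hρlo : 0 < ρlo)
    (hρb : ∀ x s σ, ρlo ≤ ρ x s σ ∧ ρ x s σ ≤ ρhi)
    (hH2 : ∀ x, x ∉ W → ∀ (s : S) (η : V → S) (F : (V → S) → ℝ), Measurable F → (∃ B, ∀ σ, |F σ| ≤ B) →
      DependsOn F (↑W : Set V) →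
      (∫ σ, F σ ∂(γ W (update η x s))) * (∫ σ, ρ x s σ ∂(γ W η)) = ∫ σ, F σ * ρ x s σ ∂(γ W η))
    -- (H3) Schur bound on the Gram rows of the tilting factors
    {Λ : ℝ} (hΛ : 0 ≤ Λ)
    (hH3 : ∀ (η : V → S) (sel : V → S) (x : V), x ∉ W →
      ∑ x' ∈ Wᶜ, |(∫ σ, ρ x (sel x) σ * ρ x' (sel x') σ ∂(γ W η)) -
        (∫ σ, ρ x (sel x) σ ∂(γ W η)) * (∫ σ, ρ x' (sel x') σ ∂(γ W η))| ≤ Λ)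
    {f : (V → S) → ℝ} (hfm : Measurable f) {M : ℝ} (hM : ∀ σ, |f σ| ≤ M) (hfdep : DependsOn f (↑W : Set V)) :
    (1 - α) * ∫ η, ((∫ σ, f σ ∂(γ W η)) - ∫ τ, (∫ σ, f σ ∂(γ W τ)) ∂μ) ^ 2 ∂μ ≤
      K * Λ / ρlo ^ 2 * ∫ σ, (f σ - ∫ τ, f τ ∂μ) ^ 2 ∂μ := by
  haveI := hμ.isProbabilityMeasure
  set h : (V → S) → ℝ := fun η => ∫ σ, f σ ∂(γ W η) with hh
  have hhm : Measurable h := measurable_kernelAvg hγ W hfm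
  have hhb : ∀ η, |h η| ≤ M := hγ.abs_integral_le W hM
  -- (P) Poincaré for `h`
  have hP := poincare_of_isKRContraction_one hγ hC hrow hμ hhm hhb
  refine hP.trans ?_
  -- sites inside `W` do not contribute
  have hzero : ∀ x ∈ W, ∫ η, (h η - siteAvg γ x h η) ^ 2 ∂μ = 0 := by
    intro x hx
    have : ∀ η, siteAvg γ x h η = h η := fun η =>
      siteAvg_of_forall_update hγ x hhm (fun η s => by simp only [hh]; rw [kernel_update_of_mem hγ hx]) η
    simp [this]
  have hsplit : ∑ x, ∫ η, (h η - siteAvg γ x h η) ^ 2 ∂μ = ∑ x ∈ Wᶜ, ∫ η, (h η - siteAvg γ x h η) ^ 2 ∂μ := by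
    rw [← sum_compl_add_sum W, sum_eq_zero hzero, add_zero]
  rw [hsplit]
  -- constants
  set Mρ : ℝ := |ρlo| + |ρhi| with hMρ
  have hρabs : ∀ x s σ, |ρ x s σ| ≤ Mρ := fun x s σ => by
    obtain ⟨h1, h2⟩ := hρb x s σ
    rw [hMρ]
    rcases le_or_gt 0 (ρ x s σ) with h0 | h0
    · rw [abs_of_nonneg h0]; exact h2.trans ((le_abs_self _).trans (le_add_of_nonneg_left (abs_nonneg _)))
    · rw [abs_of_neg h0]; have := neg_le_abs ρlo; linarith [abs_nonneg ρhi]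
  have hρlo2 : 0 < ρlo ^ 2 := pow_pos hρlo 2
  -- marginals of the product reference measure
  have hmarg : ∀ (x : V) (φ : S → ℝ), Measurable φ →
      ∫ sel, φ (sel x) ∂(Measure.pi fun _ : V => m) = ∫ s, φ s ∂m := by
    intro x φ hφ
    have hmp := (measurePreserving_eval (μ := fun _ : V => m) x).map_eq
    calc ∫ sel, φ (sel x) ∂(Measure.pi fun _ : V => m)
        = ∫ s, φ s ∂(Measure.map (Function.eval x) (Measure.pi fun _ : V => m)) :=
          (integral_map (measurable_pi_apply x).aemeasurable hφ.aestronglyMeasurable).symm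
      _ = ∫ s, φ s ∂m := by rw [hmp]
  haveI : IsProbabilityMeasure (Measure.pi fun _ : V => m) := by infer_instance
  -- pointwise in `η`: `∑_{x ∉ W} (h η − T_x h η)² ≤ (K Λ / ρlo²) · Var_{γ_W(η)}(f)`
  set Vf : (V → S) → ℝ := fun η => (∫ σ, f σ ^ 2 ∂(γ W η)) - (∫ σ, f σ ∂(γ W η)) ^ 2 with hVf
  have hpt : ∀ η, ∑ x ∈ Wᶜ, (h η - siteAvg γ x h η) ^ 2 ≤ K * Λ / ρlo ^ 2 * Vf η := by
    intro η
    haveI := hγ.isProbability W η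
    set ν := γ W η with hν
    -- centred objects under `ν`
    set fc : (V → S) → ℝ := fun σ => f σ - ∫ τ, f τ ∂ν with hfc
    have hfcm : Measurable fc := hfm.sub_const _
    have hfcb : ∀ σ, |fc σ| ≤ M + M := fun σ =>
      (abs_sub _ _).trans (add_le_add (hM σ) (by simpa using hγ.abs_integral_le W hM η))
    have hVfeq : Vf η = ∫ σ, fc σ ^ 2 ∂ν := integral_sq_sub_sq_integral ν hfm hM
    -- covariance of `f` with the tilting factor, and the lower bound on its mean
    have hE : ∀ x s, ρlo ≤ ∫ σ, ρ x s σ ∂ν := fun x s => by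
      have := integral_mono (integrable_const ρlo) (integrable_of_abs_le_const ν (hρm x s) (hρabs x s))
        fun σ => (hρb x s σ).1
      simpa using this
    have hcov : ∀ x s, (∫ σ, f σ * ρ x s σ ∂ν) - (∫ σ, f σ ∂ν) * (∫ σ, ρ x s σ ∂ν) =
        ∫ σ, fc σ * (ρ x s σ - ∫ τ, ρ x s τ ∂ν) ∂ν := fun x s =>
      integral_mul_sub_eq_centred ν hfm (hρm x s) hM (hρabs x s)
    -- the difference quotient
    have hdq : ∀ x, x ∉ W → ∀ s, (h η - h (update η x s)) ^ 2 ≤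
        (∫ σ, fc σ * (ρ x s σ - ∫ τ, ρ x s τ ∂ν) ∂ν) ^ 2 / ρlo ^ 2 := by
      intro x hx s
      have hEx := hE x s
      have hEpos : 0 < ∫ σ, ρ x s σ ∂ν := hρlo.trans_le hEx
      have h2 := hH2 x hx s η f hfm ⟨M, hM⟩ hfdep
      have hdiff : h η - h (update η x s) =
          -(((∫ σ, f σ * ρ x s σ ∂ν) - (∫ σ, f σ ∂ν) * (∫ σ, ρ x s σ ∂ν)) / ∫ σ, ρ x s σ ∂ν) := by
        have hh' : h (update η x s) = (∫ σ, f σ * ρ x s σ ∂ν) / ∫ σ, ρ x s σ ∂ν := by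
          rw [eq_div_iff hEpos.ne']; exact h2
        rw [hh']
        field_simp
        simp only [hh, hν]
        ring
      rw [hdiff, neg_sq, div_pow, hcov x s]
      exact div_le_div_of_nonneg_left (sq_nonneg _) hρlo2 (pow_le_pow_left₀ hρlo.le hEx 2)
    -- Jensen + (H1): `(h η − T_x h η)² ≤ K ∫ (h η − h(η^{x←s}))² dm(s)`
    have hstepA : ∀ x, (h η - siteAvg γ x h η) ^ 2 ≤ K * ∫ s, (h η - h (update η x s)) ^ 2 ∂m := by
      intro x
      refine (sq_sub_siteAvg_le hγ x hhm hhb η).trans (hH1 x η _ ?_ (fun s => sq_nonneg _) ⟨(M + M) ^ 2, ?_⟩)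
      · exact (measurable_const.sub (hhm.comp (measurable_update η))).pow_const 2
      · intro s
        have hb : |h η - h (update η x s)| ≤ M + M := (abs_sub _ _).trans (add_le_add (hhb _) (hhb _))
        calc (h η - h (update η x s)) ^ 2 = |h η - h (update η x s)| ^ 2 := (sq_abs _).symm
          _ ≤ (M + M) ^ 2 := pow_le_pow_left₀ (abs_nonneg _) hb 2
    -- Bessel for every selection
    have hstepC : ∀ sel : V → S,
        ∑ x ∈ Wᶜ, (h η - h (update η x (sel x))) ^ 2 ≤ Λ / ρlo ^ 2 * Vf η := by
      intro sel
      have hB := sum_sq_integral_mul_le ν Wᶜ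
        (u := fun x σ => ρ x (sel x) σ - ∫ τ, ρ x (sel x) τ ∂ν) (w := fc)
        (fun x _ => (hρm x (sel x)).sub_const _) hfcm (Mu := Mρ + Mρ) (Mw := M + M)
        (fun x _ σ => (abs_sub _ _).trans (add_le_add (hρabs _ _ _)
          (by simpa using hγ.abs_integral_le W (hρabs x (sel x)) η))) hfcb hΛ ?_
      · calc ∑ x ∈ Wᶜ, (h η - h (update η x (sel x))) ^ 2
            ≤ ∑ x ∈ Wᶜ, (∫ σ, fc σ * (ρ x (sel x) σ - ∫ τ, ρ x (sel x) τ ∂ν) ∂ν) ^ 2 / ρlo ^ 2 :=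
              sum_le_sum fun x hx => hdq x (Finset.mem_compl.1 hx) (sel x)
          _ = (∑ x ∈ Wᶜ, (∫ σ, fc σ * (ρ x (sel x) σ - ∫ τ, ρ x (sel x) τ ∂ν) ∂ν) ^ 2) / ρlo ^ 2 := by
              rw [sum_div]
          _ ≤ (Λ * ∫ σ, fc σ ^ 2 ∂ν) / ρlo ^ 2 := div_le_div_of_nonneg_right hB hρlo2.le
          _ = Λ / ρlo ^ 2 * Vf η := by rw [hVfeq]; ring
      · -- Gram rows from (H3)
        intro x hx
        have h3 := hH3 η sel x (Finset.mem_compl.1 hx)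
        refine le_trans (le_of_eq (sum_congr rfl fun x' _ => ?_)) h3
        rw [← integral_mul_sub_eq_centred ν (hρm x (sel x)) (hρm x' (sel x')) (hρabs _ _) (hρabs _ _)]
    -- assemble: sum of (H1)-bounds = product integral of the selection sums
    have hmeas_sel : Measurable fun sel : V → S => ∑ x ∈ Wᶜ, (h η - h (update η x (sel x))) ^ 2 :=
      Finset.measurable_sum _ fun x _ =>
        (measurable_const.sub (hhm.comp ((measurable_update η).comp (measurable_pi_apply x)))).pow_const 2
    have hbdd_sel : ∀ sel : V → S, |∑ x ∈ Wᶜ, (h η - h (update η x (sel x))) ^ 2| ≤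
        ∑ _x ∈ Wᶜ, (M + M) ^ 2 := fun sel => by
      rw [abs_of_nonneg (sum_nonneg fun x _ => sq_nonneg _)]
      refine sum_le_sum fun x _ => ?_
      have hb : |h η - h (update η x (sel x))| ≤ M + M := (abs_sub _ _).trans (add_le_add (hhb _) (hhb _))
      calc (h η - h (update η x (sel x))) ^ 2 = |h η - h (update η x (sel x))| ^ 2 := (sq_abs _).symm
        _ ≤ (M + M) ^ 2 := pow_le_pow_left₀ (abs_nonneg _) hb 2
    calc ∑ x ∈ Wᶜ, (h η - siteAvg γ x h η) ^ 2
        ≤ ∑ x ∈ Wᶜ, K * ∫ s, (h η - h (update η x s)) ^ 2 ∂m := sum_le_sum fun x _ => hstepA x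
      _ = K * ∑ x ∈ Wᶜ, ∫ sel, (h η - h (update η x (sel x))) ^ 2 ∂(Measure.pi fun _ : V => m) := by
          rw [mul_sum]
          refine sum_congr rfl fun x _ => ?_
          rw [hmarg x (fun s => (h η - h (update η x s)) ^ 2)
            ((measurable_const.sub (hhm.comp (measurable_update η))).pow_const 2)]
      _ = K * ∫ sel, ∑ x ∈ Wᶜ, (h η - h (update η x (sel x))) ^ 2 ∂(Measure.pi fun _ : V => m) := by
          rw [integral_finsetSum _ fun x _ => ?_]
          exact integrable_of_abs_le_const _
            ((measurable_const.sub (hhm.comp ((measurable_update η).comp (measurable_pi_apply x)))).pow_const 2)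
            (M := (M + M) ^ 2) fun sel => by
              rw [abs_of_nonneg (sq_nonneg _)]
              have hb : |h η - h (update η x (sel x))| ≤ M + M :=
                (abs_sub _ _).trans (add_le_add (hhb _) (hhb _))
              calc (h η - h (update η x (sel x))) ^ 2 = |h η - h (update η x (sel x))| ^ 2 := (sq_abs _).symm
                _ ≤ (M + M) ^ 2 := pow_le_pow_left₀ (abs_nonneg _) hb 2
      _ ≤ K * ∫ _sel, Λ / ρlo ^ 2 * Vf η ∂(Measure.pi fun _ : V => m) := by
          refine mul_le_mul_of_nonneg_left (integral_mono (integrable_of_abs_le_const _ hmeas_sel hbdd_sel)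
            (integrable_const _) fun sel => hstepC sel) hK
      _ = K * Λ / ρlo ^ 2 * Vf η := by simp; ring
  -- integrate over `μ`
  have hΛ0 : 0 ≤ K * Λ / ρlo ^ 2 := div_nonneg (mul_nonneg hK hΛ) hρlo2.le
  have hint_sq : ∀ x, Integrable (fun η => (h η - siteAvg γ x h η) ^ 2) μ := fun x =>
    integrable_of_abs_le_const μ ((hhm.sub (measurable_siteAvg hγ x hhm)).pow_const 2) (M := (M + M) ^ 2)
      fun η => by
        rw [abs_of_nonneg (sq_nonneg _)]
        have hb : |h η - siteAvg γ x h η| ≤ M + M :=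
          (abs_sub _ _).trans (add_le_add (hhb _) (abs_siteAvg_le hγ x hhb η))
        calc (h η - siteAvg γ x h η) ^ 2 = |h η - siteAvg γ x h η| ^ 2 := (sq_abs _).symm
          _ ≤ (M + M) ^ 2 := pow_le_pow_left₀ (abs_nonneg _) hb 2
  have hf2m : Measurable fun σ => f σ ^ 2 := hfm.pow_const 2
  have hf2b : ∀ σ, |f σ ^ 2| ≤ M ^ 2 := fun σ => by
    rw [abs_pow]; exact pow_le_pow_left₀ (abs_nonneg _) (hM σ) 2
  have hVfm : Measurable Vf := (measurable_kernelAvg hγ W hf2m).sub (hhm.pow_const 2)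
  have hVfb : ∀ η, |Vf η| ≤ M ^ 2 + M ^ 2 := fun η => by
    refine (abs_sub _ _).trans (add_le_add (hγ.abs_integral_le W hf2b η) ?_)
    rw [abs_pow]; exact pow_le_pow_left₀ (abs_nonneg _) (hhb η) 2
  calc ∑ x ∈ Wᶜ, ∫ η, (h η - siteAvg γ x h η) ^ 2 ∂μ
      = ∫ η, ∑ x ∈ Wᶜ, (h η - siteAvg γ x h η) ^ 2 ∂μ := (integral_finsetSum _ fun x _ => hint_sq x).symm
    _ ≤ ∫ η, K * Λ / ρlo ^ 2 * Vf η ∂μ :=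
        integral_mono (integrable_finsetSum _ fun x _ => hint_sq x)
          ((integrable_of_abs_le_const μ hVfm hVfb).const_mul _) hpt
    _ = K * Λ / ρlo ^ 2 * ∫ η, Vf η ∂μ := integral_const_mul _ _
    _ ≤ K * Λ / ρlo ^ 2 * ∫ σ, (f σ - ∫ τ, f τ ∂μ) ^ 2 ∂μ :=
        mul_le_mul_of_nonneg_left (integral_kernelVar_le hγ hμ W hfm hM) hΛ0

end Transfer

end Summit.QuantumFields.YangMills.Cruxes.IR.ShellMaxCorr.HeatBath

end
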